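import Summits.Ventures.CertifiedManyBodySolver.Downfold.EmeryOrbitalWeightFaceDirBox
import Summits.Ventures.CertifiedManyBodySolver.Downfold.EmeryVanHoveSubBox
import Summits.Ventures.CertifiedManyBodySolver.Downfold.EmeryVanHoveTableB
import Summits.Ventures.CertifiedManyBodySolver.Downfold.EmeryVanHoveTableF
import Summits.Ventures.CertifiedManyBodySolver.Downfold.EmeryFermiFaceDirPointsHg1201NH116S1
import Summits.Ventures.CertifiedManyBodySolver.Downfold.EmeryFermiFaceDirPointsHg1201NH116S2
import Summits.Ventures.CertifiedManyBodySolver.Downfold.EmeryFermiFaceDirPointsHg1201NH116S3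
import HarnessLib

/-!
# THE ANTINODAL FERMI-SURFACE Cu-d WEIGHT OVER THE TYPED 3BE BOX `emeryBoxHg1201 (EmeryBoxesCuprates)` AT FILLING n_H = 1.16 (ν = 21/50), regime-free rule v2 — the kinematic leg of the UPPER member
# `U_B∣full(w_antinode)` of the weak band-level `U` bracket read over a box where the v1 rule's antinodal charge-transfer regime FAILS at the low-Δ corners
# (INFL-3to1-B §B.90 (j); kernel `EmeryOrbitalWeightFaceDirBox`; router/EMERY-FS-WEIGHT-BRACKETS.tsv / OBJECT-E-BUDGET.tsv §C)

Venture CertifiedManyBodySolver, cell `pub/hubbard-downfold` (stage S1), seat hubbard-downfold-mod-4 (technique B, g39); namespace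
`Summit.Ventures.CertifiedManyBodySolver.Downfold.Emery`. Everything PROVED (0 sorry). WHAT THIS IS NOT: a statement about the material — the typed box (HgBa₂CuO₄ (box #19, P = 0))
is SCREENING-GRADE; `U = 0` one-body kinematics of the σ model; the `U_B` arithmetic that consumes the window is DERIVED context on the MEAN-FIELD annex (R-B17).

For every member θ = (Δ, t_pd, t_pp, t_pp′) ∈ [1.4, 2.5] × [1.12, 1.32] × [0.64, 0.85] × [0.161, 0.208] eV at filling ν = 21/50, the Cu-d weight of the ANTINODAL Bloch state,
`dWeightFace θ (fermiEnergyOf θ ν)`, lies in the window below. DEVICE (v2): `W(θ) = W(Δ/t_pd, 1, t_pp/t_pd, t_pp′/t_pd)` (scaling law); the t_pd range is cut into 3 slabs; on each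
normalised slab the v2 CORNER RULE `dWeightFace_fermiEnergyOf_mem_Icc_of_mem_box3_dir_num`: Δ ↑ at fixed filling WITHOUT the regime (region-wide directional certificate
`faceDir_nonneg_of_mem_region`, κ₀ = 1/10, + the Fermi-energy slope law κ = 1/10 + mean value theorem), t_pp ↓, t_pp′ ↑ only at the upper corner (regime margin R2 there),
lower end `t_pp′`-decoupled (`dWeightFaceLoDec` at `E_h`); hole-likeness from the slab's `vhBoxCheck` + the Ψ table; two K = 384 Fermi-energy brackets per slab
(`EmeryFermiFaceDirPointsHg1201NH116S<k>`). The slab corners are VIRTUAL (not members): the window is a sound ENCLOSURE (lower end ≈ 0.02 below the v1 virtual-corner value).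

| t_pd slab (eV) | normalised slab Δ/t_pd × t_pp/t_pd × t_pp′/t_pd | q₁ (vhBoxCheck) ≥ table point | E_h | E_v | margins (R2, 1 − κ − w̄_axis) | **w_face window** |
|---|---|---|---|---|---|---|
| [1.12, 1.187] | [1.18, 2.232] × [0.5393, 0.7589] × [0.1357, 0.1857] | 0.5812 ≥ 14/25 (Ψ ≤ 0.3858) | 1.496 | 1.0525 | +0.384, +0.104 | **[0.6195, 0.7843]** |
| [1.187, 1.253] | [1.117, 2.107] × [0.5106, 0.7163] × [0.1285, 0.1753] | 0.5617 ≥ 14/25 (Ψ ≤ 0.3858) | 1.5104 | 1.0844 | +0.447, +0.115 | **[0.6162, 0.7741]** |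
| [1.253, 1.32] | [1.061, 1.995] × [0.4848, 0.6782] × [0.122, 0.166] | 0.5431 ≥ 27/50 (Ψ ≤ 0.3881) | 1.5253 | 1.114 | +0.505, +0.125 | **[0.6128, 0.7645]** |
| **whole box** | (hull of the slabs) | | | | | **[0.6128, 0.7843]** |

Sources: three-band model [HybertsenSchluterChristensen1989, Eq. (1)]; face point of the bilinear contour [AndersenEtAl1995, §6]; [folklore] algebra.
-/

noncomputable section

namespace Summit.Ventures.CertifiedManyBodySolver.Downfold.Emery

open Real Set

/-- **Slab 1 (t_pd ∈ [1.12, 1.187] eV) of `emeryBoxHg1201 (EmeryBoxesCuprates)`, ν = 21/50: the antinodal Fermi-surface Cu-d weight of every member lies in `[0.6195, 0.7843]`**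
(normalised-slab v2 corner rule; brackets `faceDirPt_Hg1201_nH116_s1_lo_br` / `_hi_br`). [folklore] -/
theorem hg1201Box_dWeightFaceDir_nH116_s1 {Δ a b c : ℝ} (hΔ : Δ ∈ Icc ((7 : ℝ) / 5) ((5 : ℝ) / 2)) (ha : a ∈ Icc ((28 : ℝ) / 25) ((89 : ℝ) / 75)) (hb : b ∈ Icc ((16 : ℝ) / 25) ((17 : ℝ) / 20)) (hc : c ∈ Icc ((161 : ℝ) / 1000) ((26 : ℝ) / 125)) :
    dWeightFace Δ a b c (fermiEnergyOf Δ a b c ((21 : ℝ) / 50)) ∈ Icc ((1239 : ℝ) / 2000) ((7843 : ℝ) / 10000) := by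
  have ha0 : 0 < a := lt_of_lt_of_le (by norm_num) ha.1
  rw [dWeightFace_fermiEnergyOf_eq_ratios ha0]
  have hΔn : Δ / a ∈ Icc ((105 : ℝ) / 89) ((125 : ℝ) / 56) := by
    constructor
    · rw [le_div_iff₀ ha0]; linarith [hΔ.1, ha.2]
    · rw [div_le_iff₀ ha0]; linarith [hΔ.2, ha.1]
  have hbn : b / a ∈ Icc ((48 : ℝ) / 89) ((85 : ℝ) / 112) := by
    constructor
    · rw [le_div_iff₀ ha0]; linarith [hb.1, ha.2]
    · rw [div_le_iff₀ ha0]; linarith [hb.2, ha.1]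
  have hcn : c / a ∈ Icc ((483 : ℝ) / 3560) ((13 : ℝ) / 70) := by
    constructor
    · rw [le_div_iff₀ ha0]; linarith [hc.1, ha.2]
    · rw [div_le_iff₀ ha0]; linarith [hc.2, ha.1]
  have hVH : ∀ Δ' b' c' : ℝ, Δ' ∈ Icc ((105 : ℝ) / 89) ((125 : ℝ) / 56) → b' ∈ Icc ((48 : ℝ) / 89) ((85 : ℝ) / 112) → c' ∈ Icc ((483 : ℝ) / 3560) ((13 : ℝ) / 70) →
      1 - 2 * ((21 : ℝ) / 50) ≤ xVH Δ' 1 b' c' := by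
    intro Δ' b' c' hΔ' hb' hc'
    have h := xVH_window_of_vhBoxCheck (Δ₁ := ((105 : ℚ) / 89)) (Δ₂ := ((125 : ℚ) / 56)) (a₁ := (1 : ℚ)) (a₂ := (1 : ℚ)) (b₁ := ((48 : ℚ) / 89)) (b₂ := ((85 : ℚ) / 112))
      (c₁ := ((483 : ℚ) / 3560)) (c₂ := ((13 : ℚ) / 70)) (v₁ := ((201 : ℚ) / 200)) (v₂ := ((3291 : ℚ) / 2500)) (e := ((12577 : ℚ) / 10000)) (E := ((10467 : ℚ) / 10000))
      (q₁ := ((1453 : ℚ) / 2500)) (q₂ := ((13759 : ℚ) / 10000)) (by decide +kernel)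
      (Δ := Δ') (tpd := 1) (tpp := b') (c := c') (by simpa using hΔ') (by simp) (by simpa using hb') (by simpa using hc')
    obtain ⟨-, -, -, -, -, hwin⟩ := h
    push_cast at hwin
    have ht := vhFrac_14_25
    have hmono := vhFrac_anti (show (14 / 25 : ℝ) ≤ ((1453 : ℝ) / 2500) by norm_num)
    have hnu : ((56885 : ℝ) / 147456) ≤ ((21 : ℝ) / 50) := by norm_num
    linarith [hwin.1, ht.2]
  have hEh := (fermiEnergyOf_of_pointBracketCheck faceDirPt_Hg1201_nH116_s1_lo_br (by norm_num) (by norm_num) (by norm_num) (ν := (21/50 : ℝ))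
    (by push_cast; exact ⟨le_rfl, le_rfl⟩)).2
  have hEv := (fermiEnergyOf_of_pointBracketCheck faceDirPt_Hg1201_nH116_s1_hi_br (by norm_num) (by norm_num) (by norm_num) (ν := (21/50 : ℝ))
    (by push_cast; exact ⟨le_rfl, le_rfl⟩)).2
  push_cast at hEh hEv
  refine dWeightFace_fermiEnergyOf_mem_Icc_of_mem_box3_dir_num (Eh := ((187 : ℝ) / 125)) (Ev := ((421 : ℝ) / 400)) (Elow := ((417 : ℝ) / 400)) (κ₀ := 1 / 10) (κ := 1 / 10)
    (by norm_num) one_pos (by norm_num) (by norm_num) (by norm_num) hΔn hbn hcn (by norm_num) (by norm_num) hVH hEh.2 (by norm_num)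
    (by norm_num [faceU, fsD, fsN, cA]) (by norm_num [faceU, fsD, fsN, cA]) (by norm_num [faceU, fsD, fsN, cA]) (by norm_num [faceU, fsD, fsN, cA])
    hEv.1 (by norm_num) (by norm_num) (by norm_num [faceG]) (by norm_num) (by norm_num) (by norm_num) le_rfl (by norm_num [dWeightAxisCF])
    (by norm_num) (by norm_num) ?_ (by norm_num [dWeightFaceLoDec, faceRUp, faceN]) (by norm_num [dWeightFaceCF, faceN, faceR, fsN])
  intro D B C e hD hB hC he hG
  exact faceDir_nonneg_of_mem_region ⟨le_trans (by norm_num) hD.1, le_trans hD.2 (by norm_num)⟩ ⟨le_trans (by norm_num) he.1, le_trans he.2 (by norm_num)⟩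
    ⟨le_trans (by norm_num) hB.1, le_trans hB.2 (by norm_num)⟩ ⟨le_trans (by norm_num) hC.1, le_trans hC.2 (by norm_num)⟩ hG

/-- **Slab 2 (t_pd ∈ [1.187, 1.253] eV) of `emeryBoxHg1201 (EmeryBoxesCuprates)`, ν = 21/50: the antinodal Fermi-surface Cu-d weight of every member lies in `[0.6162, 0.7741]`**
(normalised-slab v2 corner rule; brackets `faceDirPt_Hg1201_nH116_s2_lo_br` / `_hi_br`). [folklore] -/
theorem hg1201Box_dWeightFaceDir_nH116_s2 {Δ a b c : ℝ} (hΔ : Δ ∈ Icc ((7 : ℝ) / 5) ((5 : ℝ) / 2)) (ha : a ∈ Icc ((89 : ℝ) / 75) ((94 : ℝ) / 75)) (hb : b ∈ Icc ((16 : ℝ) / 25) ((17 : ℝ) / 20)) (hc : c ∈ Icc ((161 : ℝ) / 1000) ((26 : ℝ) / 125)) :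
    dWeightFace Δ a b c (fermiEnergyOf Δ a b c ((21 : ℝ) / 50)) ∈ Icc ((3081 : ℝ) / 5000) ((7741 : ℝ) / 10000) := by
  have ha0 : 0 < a := lt_of_lt_of_le (by norm_num) ha.1
  rw [dWeightFace_fermiEnergyOf_eq_ratios ha0]
  have hΔn : Δ / a ∈ Icc ((105 : ℝ) / 94) ((375 : ℝ) / 178) := by
    constructor
    · rw [le_div_iff₀ ha0]; linarith [hΔ.1, ha.2]
    · rw [div_le_iff₀ ha0]; linarith [hΔ.2, ha.1]
  have hbn : b / a ∈ Icc ((24 : ℝ) / 47) ((255 : ℝ) / 356) := by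
    constructor
    · rw [le_div_iff₀ ha0]; linarith [hb.1, ha.2]
    · rw [div_le_iff₀ ha0]; linarith [hb.2, ha.1]
  have hcn : c / a ∈ Icc ((483 : ℝ) / 3760) ((78 : ℝ) / 445) := by
    constructor
    · rw [le_div_iff₀ ha0]; linarith [hc.1, ha.2]
    · rw [div_le_iff₀ ha0]; linarith [hc.2, ha.1]
  have hVH : ∀ Δ' b' c' : ℝ, Δ' ∈ Icc ((105 : ℝ) / 94) ((375 : ℝ) / 178) → b' ∈ Icc ((24 : ℝ) / 47) ((255 : ℝ) / 356) → c' ∈ Icc ((483 : ℝ) / 3760) ((78 : ℝ) / 445) →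
      1 - 2 * ((21 : ℝ) / 50) ≤ xVH Δ' 1 b' c' := by
    intro Δ' b' c' hΔ' hb' hc'
    have h := xVH_window_of_vhBoxCheck (Δ₁ := ((105 : ℚ) / 94)) (Δ₂ := ((375 : ℚ) / 178)) (a₁ := (1 : ℚ)) (a₂ := (1 : ℚ)) (b₁ := ((24 : ℚ) / 47)) (b₂ := ((255 : ℚ) / 356))
      (c₁ := ((483 : ℚ) / 3760)) (c₂ := ((78 : ℚ) / 445)) (v₁ := ((2599 : ℚ) / 2500)) (v₂ := ((2689 : ℚ) / 2000)) (e := ((6439 : ℚ) / 5000)) (E := ((1351 : ℚ) / 1250))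
      (q₁ := ((5617 : ℚ) / 10000)) (q₂ := ((12913 : ℚ) / 10000)) (by decide +kernel)
      (Δ := Δ') (tpd := 1) (tpp := b') (c := c') (by simpa using hΔ') (by simp) (by simpa using hb') (by simpa using hc')
    obtain ⟨-, -, -, -, -, hwin⟩ := h
    push_cast at hwin
    have ht := vhFrac_14_25
    have hmono := vhFrac_anti (show (14 / 25 : ℝ) ≤ ((5617 : ℝ) / 10000) by norm_num)
    have hnu : ((56885 : ℝ) / 147456) ≤ ((21 : ℝ) / 50) := by norm_num
    linarith [hwin.1, ht.2]
  have hEh := (fermiEnergyOf_of_pointBracketCheck faceDirPt_Hg1201_nH116_s2_lo_br (by norm_num) (by norm_num) (by norm_num) (ν := (21/50 : ℝ))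
    (by push_cast; exact ⟨le_rfl, le_rfl⟩)).2
  have hEv := (fermiEnergyOf_of_pointBracketCheck faceDirPt_Hg1201_nH116_s2_hi_br (by norm_num) (by norm_num) (by norm_num) (ν := (21/50 : ℝ))
    (by push_cast; exact ⟨le_rfl, le_rfl⟩)).2
  push_cast at hEh hEv
  refine dWeightFace_fermiEnergyOf_mem_Icc_of_mem_box3_dir_num (Eh := ((944 : ℝ) / 625)) (Ev := ((2711 : ℝ) / 2500)) (Elow := ((1343 : ℝ) / 1250)) (κ₀ := 1 / 10) (κ := 1 / 10)
    (by norm_num) one_pos (by norm_num) (by norm_num) (by norm_num) hΔn hbn hcn (by norm_num) (by norm_num) hVH hEh.2 (by norm_num)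
    (by norm_num [faceU, fsD, fsN, cA]) (by norm_num [faceU, fsD, fsN, cA]) (by norm_num [faceU, fsD, fsN, cA]) (by norm_num [faceU, fsD, fsN, cA])
    hEv.1 (by norm_num) (by norm_num) (by norm_num [faceG]) (by norm_num) (by norm_num) (by norm_num) le_rfl (by norm_num [dWeightAxisCF])
    (by norm_num) (by norm_num) ?_ (by norm_num [dWeightFaceLoDec, faceRUp, faceN]) (by norm_num [dWeightFaceCF, faceN, faceR, fsN])
  intro D B C e hD hB hC he hG
  exact faceDir_nonneg_of_mem_region ⟨le_trans (by norm_num) hD.1, le_trans hD.2 (by norm_num)⟩ ⟨le_trans (by norm_num) he.1, le_trans he.2 (by norm_num)⟩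
    ⟨le_trans (by norm_num) hB.1, le_trans hB.2 (by norm_num)⟩ ⟨le_trans (by norm_num) hC.1, le_trans hC.2 (by norm_num)⟩ hG

/-- **Slab 3 (t_pd ∈ [1.253, 1.32] eV) of `emeryBoxHg1201 (EmeryBoxesCuprates)`, ν = 21/50: the antinodal Fermi-surface Cu-d weight of every member lies in `[0.6128, 0.7645]`**
(normalised-slab v2 corner rule; brackets `faceDirPt_Hg1201_nH116_s3_lo_br` / `_hi_br`). [folklore] -/
theorem hg1201Box_dWeightFaceDir_nH116_s3 {Δ a b c : ℝ} (hΔ : Δ ∈ Icc ((7 : ℝ) / 5) ((5 : ℝ) / 2)) (ha : a ∈ Icc ((94 : ℝ) / 75) ((33 : ℝ) / 25)) (hb : b ∈ Icc ((16 : ℝ) / 25) ((17 : ℝ) / 20)) (hc : c ∈ Icc ((161 : ℝ) / 1000) ((26 : ℝ) / 125)) :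
    dWeightFace Δ a b c (fermiEnergyOf Δ a b c ((21 : ℝ) / 50)) ∈ Icc ((383 : ℝ) / 625) ((1529 : ℝ) / 2000) := by
  have ha0 : 0 < a := lt_of_lt_of_le (by norm_num) ha.1
  rw [dWeightFace_fermiEnergyOf_eq_ratios ha0]
  have hΔn : Δ / a ∈ Icc ((35 : ℝ) / 33) ((375 : ℝ) / 188) := by
    constructor
    · rw [le_div_iff₀ ha0]; linarith [hΔ.1, ha.2]
    · rw [div_le_iff₀ ha0]; linarith [hΔ.2, ha.1]
  have hbn : b / a ∈ Icc ((16 : ℝ) / 33) ((255 : ℝ) / 376) := by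
    constructor
    · rw [le_div_iff₀ ha0]; linarith [hb.1, ha.2]
    · rw [div_le_iff₀ ha0]; linarith [hb.2, ha.1]
  have hcn : c / a ∈ Icc ((161 : ℝ) / 1320) ((39 : ℝ) / 235) := by
    constructor
    · rw [le_div_iff₀ ha0]; linarith [hc.1, ha.2]
    · rw [div_le_iff₀ ha0]; linarith [hc.2, ha.1]
  have hVH : ∀ Δ' b' c' : ℝ, Δ' ∈ Icc ((35 : ℝ) / 33) ((375 : ℝ) / 188) → b' ∈ Icc ((16 : ℝ) / 33) ((255 : ℝ) / 376) → c' ∈ Icc ((161 : ℝ) / 1320) ((39 : ℝ) / 235) →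
      1 - 2 * ((21 : ℝ) / 50) ≤ xVH Δ' 1 b' c' := by
    intro Δ' b' c' hΔ' hb' hc'
    have h := xVH_window_of_vhBoxCheck (Δ₁ := ((35 : ℚ) / 33)) (Δ₂ := ((375 : ℚ) / 188)) (a₁ := (1 : ℚ)) (a₂ := (1 : ℚ)) (b₁ := ((16 : ℚ) / 33)) (b₂ := ((255 : ℚ) / 376))
      (c₁ := ((161 : ℚ) / 1320)) (c₂ := ((39 : ℚ) / 235)) (v₁ := ((10721 : ℚ) / 10000)) (v₂ := ((1713 : ℚ) / 1250)) (e := ((13157 : ℚ) / 10000)) (E := ((11127 : ℚ) / 10000))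
      (q₁ := ((5431 : ℚ) / 10000)) (q₂ := ((12153 : ℚ) / 10000)) (by decide +kernel)
      (Δ := Δ') (tpd := 1) (tpp := b') (c := c') (by simpa using hΔ') (by simp) (by simpa using hb') (by simpa using hc')
    obtain ⟨-, -, -, -, -, hwin⟩ := h
    push_cast at hwin
    have ht := vhFrac_27_50
    have hmono := vhFrac_anti (show (27 / 50 : ℝ) ≤ ((5431 : ℝ) / 10000) by norm_num)
    have hnu : ((57230 : ℝ) / 147456) ≤ ((21 : ℝ) / 50) := by norm_num
    linarith [hwin.1, ht.2]
  have hEh := (fermiEnergyOf_of_pointBracketCheck faceDirPt_Hg1201_nH116_s3_lo_br (by norm_num) (by norm_num) (by norm_num) (ν := (21/50 : ℝ))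
    (by push_cast; exact ⟨le_rfl, le_rfl⟩)).2
  have hEv := (fermiEnergyOf_of_pointBracketCheck faceDirPt_Hg1201_nH116_s3_hi_br (by norm_num) (by norm_num) (by norm_num) (ν := (21/50 : ℝ))
    (by push_cast; exact ⟨le_rfl, le_rfl⟩)).2
  push_cast at hEh hEv
  refine dWeightFace_fermiEnergyOf_mem_Icc_of_mem_box3_dir_num (Eh := ((15253 : ℝ) / 10000)) (Ev := ((557 : ℝ) / 500)) (Elow := ((138 : ℝ) / 125)) (κ₀ := 1 / 10) (κ := 1 / 10)
    (by norm_num) one_pos (by norm_num) (by norm_num) (by norm_num) hΔn hbn hcn (by norm_num) (by norm_num) hVH hEh.2 (by norm_num)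
    (by norm_num [faceU, fsD, fsN, cA]) (by norm_num [faceU, fsD, fsN, cA]) (by norm_num [faceU, fsD, fsN, cA]) (by norm_num [faceU, fsD, fsN, cA])
    hEv.1 (by norm_num) (by norm_num) (by norm_num [faceG]) (by norm_num) (by norm_num) (by norm_num) le_rfl (by norm_num [dWeightAxisCF])
    (by norm_num) (by norm_num) ?_ (by norm_num [dWeightFaceLoDec, faceRUp, faceN]) (by norm_num [dWeightFaceCF, faceN, faceR, fsN])
  intro D B C e hD hB hC he hG
  exact faceDir_nonneg_of_mem_region ⟨le_trans (by norm_num) hD.1, le_trans hD.2 (by norm_num)⟩ ⟨le_trans (by norm_num) he.1, le_trans he.2 (by norm_num)⟩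
    ⟨le_trans (by norm_num) hB.1, le_trans hB.2 (by norm_num)⟩ ⟨le_trans (by norm_num) hC.1, le_trans hC.2 (by norm_num)⟩ hG

/-- **`emeryBoxHg1201 (EmeryBoxesCuprates)`, ν = 21/50: for EVERY member θ the Cu-d weight of the antinodal Fermi-surface state lies in `[0.6128, 0.7843]`** (hull of the 3 t_pd slab windows; regime-free rule v2). [folklore] -/
theorem hg1201Box_dWeightFaceDir_nH116 {Δ a b c : ℝ} (hΔ : Δ ∈ Icc ((7 : ℝ) / 5) ((5 : ℝ) / 2)) (ha : a ∈ Icc ((28 : ℝ) / 25) ((33 : ℝ) / 25)) (hb : b ∈ Icc ((16 : ℝ) / 25) ((17 : ℝ) / 20)) (hc : c ∈ Icc ((161 : ℝ) / 1000) ((26 : ℝ) / 125)) :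
    dWeightFace Δ a b c (fermiEnergyOf Δ a b c ((21 : ℝ) / 50)) ∈ Icc ((383 : ℝ) / 625) ((7843 : ℝ) / 10000) := by
  rcases le_or_gt a ((89 : ℝ) / 75) with h1 | h1
  · have h := hg1201Box_dWeightFaceDir_nH116_s1 hΔ ⟨ha.1, h1⟩ hb hc
    exact ⟨le_trans (by norm_num) h.1, le_trans h.2 (by norm_num)⟩
  · rcases le_or_gt a ((94 : ℝ) / 75) with h2 | h2
    · have h := hg1201Box_dWeightFaceDir_nH116_s2 hΔ ⟨h1.le, h2⟩ hb hc
      exact ⟨le_trans (by norm_num) h.1, le_trans h.2 (by norm_num)⟩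
    · have h := hg1201Box_dWeightFaceDir_nH116_s3 hΔ ⟨h2.le, ha.2⟩ hb hc
      exact ⟨le_trans (by norm_num) h.1, le_trans h.2 (by norm_num)⟩

end Summit.Ventures.CertifiedManyBodySolver.Downfold.Emery
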